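import Summits.BirchSwinnertonDyer.BirchSwinnertonDyer.Theorems.ByReductionTypeAtTwoAdditivePotGoodLowerHalfT0NarrowRankLayerBoundsDoor
import Summits.BirchSwinnertonDyer.BirchSwinnertonDyer.Theorems.ByReductionTypeAtTwoAdditivePotGoodLowerHalfT0NarrowRankTotPosUnitsCounting
import Literature.NumberTheory.NumberFields.CyclotomicTwoTowerLayerPolynomials
import HarnessLib

/-!
# Route `ByReductionTypeAtTwo` (rung K4), crux C3″ `AdditivePotGoodLowerHalfAtTwo` (item stmt-BirchSwinnertonDyer-22617):
# THE ORDER `ℤ[θ, e]` OF THE LAYER-TWO FIELD `A₂ = ℚ(θ) ⊔ ℚ_2` OF A TOTALLY REAL CUBIC FIELD — `16·disc · 𝓞_{A₂} ⊆ ℤ[θ, e]`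
# (the order input of the residue maps `𝓞_{A₂} → 𝔽_ℓ` that witness NON-SQUARE units in the kernel discharge of the hypothesis (hlow)
# `2^a ≤ #(U⁺/U²)(A₂)` of the `m = 2` narrow-rank stamps; a `--supports 22617` helper file; seat `bsd-2adic-k4-w2` GEN 16)

HONEST FRAMING (cell `bsd-2adic`, D-0036/D-0054/D-0152): GENERIC KERNEL lemmas about the compositum of ANY totally real cubic field
`ℚ(θ)` (`θ` a root of an irreducible monic integer cubic `X³ + pX² + qX + r`) with the second layer `ℚ_2 = ℚ(√(2+√2))` of the
cyclotomic `ℤ₂`-extension; no elliptic curve, no named fact, no `sorry`, no definition.  They close nothing at the `∀`-level; nothing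
booked; BSD is not proved by any of this.

PURPOSE.  The rows `279440c1`, `293200be1`, `412992bw1`, `467928d1` of the C1″/C3″ census stamp (A)₂ from two displayed unit data
(GEN 15, `AddKatoTwo.conjA_two_<L>_of_layerBounds₂₃''`), the first being (hlow) `2^a ≤ Nat.card (TotPosUnitsModSq A₂)`.  Its kernel
discharge needs, besides total positivity at the twelve real places, that `2^a − 1` explicit units of `A₂` are NOT squares — witnessed
by reduction at a degree-one prime above an odd prime `ℓ` (eng-2 CERT-NARROW6-E2 v1.3 §6.1 (W)).  A ring map `𝓞_{A₂} → 𝔽_ℓ` is built in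
the sequel `…NarrowRankLayerTwoResidueMap` from the ORDER `R = ℤ[θ, e]` (`e ∈ ℚ_2` a root of `Ψ₂ = X⁴ − 4X² + 2`) WITHOUT an integral basis of the
degree-`12` field; this file supplies the ORDER input:

* **`sixteen_mul_discr_mul_eq_sum_sup_layer_two`** — for every algebraic integer `z` of `A₂`,
  `16 · disc(X³+pX²+qX+r) · z = Σ_{i<3,k<4} c_{ik} θ^i e^k` with `c_{ik} ∈ ℤ`: the quadratic-layer lemma `2δ·𝓞_E ⊆ 𝓞_F ⊕ 𝓞_F t` (GEN 15
  `exists_two_mul_mul_eq_add_mul_of_isIntegral`) for `A₂ = A₁(e)` (`δ = 2 + s`, `s = e² − 2`, `(2−s)(2+s) = 2`) and `A₁ = ℚ(θ)(s)` (`δ = 2`),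
  then `disc · 𝓞_{ℚ(θ)} ⊆ ℤ ⊕ ℤθ ⊕ ℤθ²` (**`exists_discr_mul_eq_of_isIntegral_adjoin`**: Mathlib `Algebra.discr_mul_isIntegral_mem_adjoin` on the
  power basis `1, θ, θ²`, whose discriminant is the cubic's by k4-w1's `discr_powers_eq_cubic_discr`, and reduction modulo the monic cubic).
* `exists_eq_add_mul_of_finrank_eq_two` — a quadratic extension is `F ⊕ F t` for any `t` outside the base field (here `e ∉ A₁`, `s ∉ ℚ(θ)` by
  degrees: `Ψ₂`, `X² − 2` have no roots in the relevant fields, `NestedSqrtTwo.minpoly_eq_of_odd_finrank` / `iterate_ne_zero_of_odd_finrank`).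
The sequel proves the `ℚ`-independence of the `θ^i e^k` and assembles the ring maps `𝓞_{A₂} → 𝔽_ℓ`.

References: [Marcus1977] Ch. 2 Thm. 1, Ex. 27 and Ex. 41 (orders, `disc · 𝓞 ⊆ ℤ[θ]`); [NeukirchANT1999] Ch. I (2.9); [Washington1997] §13.1
(`ℚ_1 = ℚ(√2) ⊂ ℚ_2 = ℚ(√(2+√2))`, `K_n = Kℚ_n`); [Cohen1993] §4.1.3 (residue checks), §6.3.
-/

set_option autoImplicit false
-- sibling precedent: the directory name repeats the summit name
set_option linter.dupNamespace false

noncomputable section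

open scoped Classical IntermediateField NumberField Polynomial

namespace Summit.BirchSwinnertonDyer.BirchSwinnertonDyer.Theorems.AddKatoTwo

open Polynomial IsDedekindDomain NumberField Field IntermediateField
  Literature.NumberTheory.EllipticCurves Literature.NumberTheory.EllipticCurves.ZpExtension
  Literature.NumberTheory.IwasawaTheory Literature.NumberTheory.NumberFields
  Literature.NumberTheory.GaloisRepresentations Literature.Geometry.Kaehler.ComplexTorus

/-! ## §1 Quadratic layers are spanned by `1, t` -/

section Span

/-- **A quadratic extension `E/F` is `F ⊕ F·t` for every `t ∈ E ∖ F`.** [folklore] [cite: Marcus1977, Ch. 2 (degree-two extensions)] -/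
theorem exists_eq_add_mul_of_finrank_eq_two {F E : Type*} [Field F] [Field E] [Algebra F E]
    (h2 : Module.finrank F E = 2) (t : E) (htF : ∀ x : F, algebraMap F E x ≠ t) (z : E) :
    ∃ x y : F, z = algebraMap F E x + algebraMap F E y * t := by
  have hli : LinearIndependent F ![(1 : E), t] := by
    rw [LinearIndependent.pair_iff]
    intro a b hab
    by_cases hb : b = 0
    · subst hb
      rw [zero_smul, add_zero, smul_eq_zero] at hab
      exact ⟨hab.resolve_right one_ne_zero, rfl⟩
    · exfalso
      apply htF (-(a / b))
      rw [Algebra.smul_def, Algebra.smul_def, mul_one] at hab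
      have hb' : algebraMap F E b ≠ 0 := (_root_.map_ne_zero _).mpr hb
      rw [map_neg, map_div₀, neg_eq_iff_eq_neg, div_eq_iff hb']
      linear_combination hab
  haveI : FiniteDimensional F E := Module.finite_of_finrank_pos (by rw [h2]; norm_num)
  let B := basisOfLinearIndependentOfCardEqFinrank hli (by rw [h2]; simp)
  have hB : ⇑B = ![(1 : E), t] := coe_basisOfLinearIndependentOfCardEqFinrank hli _
  refine ⟨B.repr z 0, B.repr z 1, ?_⟩
  have h := B.sum_repr z
  rw [Fin.sum_univ_two, hB] at h
  simp only [Matrix.cons_val_zero, Matrix.cons_val_one] at h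
  rw [Algebra.smul_def, Algebra.smul_def, mul_one] at h
  exact h.symm

end Span

/-! ## §2 `disc · 𝓞_{ℚ(θ)} ⊆ ℤ[θ] = ℤ ⊕ ℤθ ⊕ ℤθ²` for a cubic field -/

section Cubic

variable {p q r : ℤ} {θ : AlgebraicClosure ℚ}

/-- **`disc(X³+pX²+qX+r) · z ∈ ℤ ⊕ ℤθ ⊕ ℤθ²` for every algebraic integer `z` of `ℚ(θ)`** (`θ` a root of the irreducible cubic): Mathlib's
`Algebra.discr_mul_isIntegral_mem_adjoin` on the power basis `1, θ, θ²` (discriminant `= disc` by k4-w1's `discr_powers_eq_cubic_discr`), and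
`ℤ[θ]` is spanned by `1, θ, θ²` (reduction modulo the monic cubic). [cite: Marcus1977, Ch. 2 Ex. 27 (`disc(α) = [𝓞:ℤ[α]]²·d_K`) and Thm. 9] -/
theorem exists_discr_mul_eq_of_isIntegral_adjoin (hirr : Irreducible (Cubic.toPoly ⟨1, (p : ℚ), q, r⟩))
    (hθ : aeval θ (Cubic.toPoly ⟨1, (p : ℚ), q, r⟩) = 0) {z : ↥ℚ⟮θ⟯} (hz : IsIntegral ℤ z) :
    ∃ n₀ n₁ n₂ : ℤ, ((Cubic.discr ⟨1, p, q, r⟩ : ℤ) : ↥ℚ⟮θ⟯) * z =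
      (n₀ : ↥ℚ⟮θ⟯) + (n₁ : ↥ℚ⟮θ⟯) * AdjoinSimple.gen ℚ θ + (n₂ : ↥ℚ⟮θ⟯) * AdjoinSimple.gen ℚ θ ^ 2 := by
  have hfm : (Cubic.toPoly ⟨1, (p : ℚ), q, r⟩).Monic := Cubic.monic_of_a_eq_one'
  have hθQ : IsIntegral ℚ θ := ⟨_, hfm, by rwa [← aeval_def]⟩
  haveI : FiniteDimensional ℚ ↥ℚ⟮θ⟯ := IntermediateField.adjoin.finiteDimensional hθQ
  set g : ↥ℚ⟮θ⟯ := AdjoinSimple.gen ℚ θ with hgdef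
  have hgroot : aeval g (Cubic.toPoly ⟨1, (p : ℚ), q, r⟩) = 0 := by
    apply (algebraMap ↥ℚ⟮θ⟯ (AlgebraicClosure ℚ)).injective
    rw [← aeval_algebraMap_apply, map_zero, hgdef, AdjoinSimple.algebraMap_gen]; exact hθ
  have hgrel : g ^ 3 + (p : ↥ℚ⟮θ⟯) * g ^ 2 + (q : ↥ℚ⟮θ⟯) * g + (r : ↥ℚ⟮θ⟯) = 0 := by
    have h := hgroot
    simp only [Cubic.toPoly, map_one, one_mul, aeval_add, aeval_mul, aeval_C, aeval_X_pow, aeval_X, eq_ratCast,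
      Rat.cast_intCast] at h
    exact h
  have hmin : minpoly ℚ θ = Cubic.toPoly ⟨1, (p : ℚ), q, r⟩ := (minpoly.eq_of_irreducible_of_monic hirr hθ hfm).symm
  have hnd : (minpoly ℚ θ).natDegree = 3 := by rw [hmin]; exact Cubic.natDegree_of_a_ne_zero' one_ne_zero
  -- the power basis of `ℚ(θ)` generated by `g`
  set pb : PowerBasis ℚ ↥ℚ⟮θ⟯ := IntermediateField.adjoin.powerBasis hθQ with hpb
  have hgen : pb.gen = g := by rw [hpb, IntermediateField.adjoin.powerBasis_gen]
  have hdim : pb.dim = 3 := by rw [hpb, IntermediateField.adjoin.powerBasis_dim, hnd]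
  have hgZ : IsIntegral ℤ g := by
    refine ⟨X ^ 3 + C p * X ^ 2 + C q * X + C r, by monicity!, ?_⟩
    simp only [eval₂_add, eval₂_mul, eval₂_pow, eval₂_C, eval₂_X]
    simp only [eq_intCast]
    exact hgrel
  have hint : IsIntegral ℤ pb.gen := hgen ▸ hgZ
  -- its discriminant is the cubic discriminant
  have hdisc : Algebra.discr ℚ ⇑pb.basis = ((Cubic.discr ⟨1, p, q, r⟩ : ℤ) : ℚ) := by
    have hb3 : ∀ i, (pb.basis.reindex (finCongr hdim)) i = g ^ (i : ℕ) := fun i => by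
      rw [Module.Basis.reindex_apply, PowerBasis.coe_basis, hgen]
      simp
    have hgrelQ : g ^ 3 + ((p : ℚ) : ↥ℚ⟮θ⟯) * g ^ 2 + ((q : ℚ) : ↥ℚ⟮θ⟯) * g + ((r : ℚ) : ↥ℚ⟮θ⟯) = 0 := by push_cast; exact hgrel
    have h := discr_powers_eq_cubic_discr g (pb.basis.reindex (finCongr hdim)) hb3 hgrelQ
    rw [Module.Basis.coe_reindex, Algebra.discr_reindex] at h
    rw [h]; simp only [Cubic.discr]; push_cast; ring
  have hmem := Algebra.discr_mul_isIntegral_mem_adjoin (R := ℤ) (K := ℚ) (B := pb) hint hz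
  rw [hgen, hdisc, Algebra.smul_def, eq_ratCast, Rat.cast_intCast] at hmem
  -- `ℤ[g]` is spanned by `1, g, g²`
  rw [Algebra.adjoin_singleton_eq_range_aeval] at hmem
  obtain ⟨P, hP⟩ := hmem
  set h3 : ℤ[X] := X ^ 3 + C p * X ^ 2 + C q * X + C r with hh3
  have hh3m : h3.Monic := by rw [hh3]; monicity!
  have hh3deg : h3.natDegree = 3 := by rw [hh3]; compute_degree!
  have hne1 : h3 ≠ 1 := by
    intro h1; have h := congrArg natDegree h1; rw [hh3deg, natDegree_one] at h; omega
  have hh3g : aeval g h3 = 0 := by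
    rw [hh3]
    simp only [map_add, map_mul, map_pow, aeval_C, aeval_X]
    simp only [eq_intCast]
    exact hgrel
  have hmod : aeval g (P %ₘ h3) = aeval g P := by
    conv_rhs => rw [← modByMonic_add_div P h3]
    rw [map_add, map_mul, hh3g, zero_mul, add_zero]
  have hdeg : (P %ₘ h3).natDegree < 3 := by
    have h := natDegree_modByMonic_lt P hh3m hne1
    rwa [hh3deg] at h
  refine ⟨(P %ₘ h3).coeff 0, (P %ₘ h3).coeff 1, (P %ₘ h3).coeff 2, ?_⟩
  have hP' : aeval g P = ((Cubic.discr ⟨1, p, q, r⟩ : ℤ) : ↥ℚ⟮θ⟯) * z := hP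
  rw [← hP', ← hmod, aeval_eq_sum_range' hdeg g]
  simp only [Finset.sum_range_succ, Finset.sum_range_zero, zero_add, pow_zero, pow_one, zsmul_eq_mul]
  ring

end Cubic

/-! ## §3 The tower `ℚ(θ) ≤ A₁ ≤ A₂` and the order containment `16·disc·𝓞_{A₂} ⊆ ℤ[θ, e]` -/

section LayerTwo

variable {p q r : ℤ} {θ : AlgebraicClosure ℚ}

set_option maxHeartbeats 1600000 in
/-- **`16 · disc · z ∈ Σ ℤ θ^i e^k` for every algebraic integer `z` of `A₂ = ℚ(θ) ⊔ ℚ_2`** (`θ` a root of the irreducible integer cubic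
`X³ + pX² + qX + r` with `ℚ(θ)` totally real, `e ∈ ℚ_2` a root of `Ψ₂`, `disc` the cubic discriminant): with `s = e² − 2 ∈ A₁ = ℚ(θ) ⊔ ℚ_1`
(`s² = 2`), `2(2+s)·z ∈ 𝓞_{A₁} ⊕ 𝓞_{A₁} e` and `4·𝓞_{A₁} ⊆ 𝓞_{ℚ(θ)} ⊕ 𝓞_{ℚ(θ)} s` (the quadratic-layer lemma twice), `disc · 𝓞_{ℚ(θ)} ⊆ ℤ ⊕ ℤθ ⊕ ℤθ²`,
and `(2 − s)(2 + s) = 2`; so `16·disc·z = (2−s)[(N₁ + N₂ s) + (M₁ + M₂ s) e]` with `Nⱼ, Mⱼ ∈ ℤ ⊕ ℤθ ⊕ ℤθ²`, a `ℤ`-combination of the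
`θ^i e^k`, `i < 3`, `k < 4`.  KERNEL; no integral basis of the degree-`12` field is used.
[cite: Marcus1977, Ch. 2 Thm. 1 and Ex. 41 (quadratic orders), Ex. 27] [cite: Washington1997, §13.1 (`ℚ_1 ⊂ ℚ_2`)] -/
theorem sixteen_mul_discr_mul_eq_sum_sup_layer_two (hirr : Irreducible (Cubic.toPoly ⟨1, (p : ℚ), q, r⟩))
    (hθ : aeval θ (Cubic.toPoly ⟨1, (p : ℚ), q, r⟩) = 0)
    (hreal : haveI : FiniteDimensional ℚ ↥ℚ⟮θ⟯ :=
        IntermediateField.adjoin.finiteDimensional ⟨_, Cubic.monic_of_a_eq_one', by rwa [← aeval_def]⟩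
      haveI : NumberField ↥ℚ⟮θ⟯ := NumberField.mk
      IsTotallyReal ↥ℚ⟮θ⟯)
    {e : AlgebraicClosure ℚ} (he : e ∈ (CyclotomicZp.zpExtension 2).layer 2) (he0 : (fun x : AlgebraicClosure ℚ => x ^ 2 - 2)^[2] e = 0)
    (z : 𝓞 ↥(ℚ⟮θ⟯ ⊔ (CyclotomicZp.zpExtension 2).layer 2)) :
    ∃ c : Fin 3 → Fin 4 → ℤ,
      ((16 * Cubic.discr ⟨1, p, q, r⟩ : ℤ) : ↥(ℚ⟮θ⟯ ⊔ (CyclotomicZp.zpExtension 2).layer 2)) * z =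
        ∑ i : Fin 3, ∑ k : Fin 4, ((c i k : ℤ) : ↥(ℚ⟮θ⟯ ⊔ (CyclotomicZp.zpExtension 2).layer 2)) *
          (inclusion (le_sup_left : ℚ⟮θ⟯ ≤ ℚ⟮θ⟯ ⊔ (CyclotomicZp.zpExtension 2).layer 2) (AdjoinSimple.gen ℚ θ) ^ (i : ℕ) *
            (⟨e, (le_sup_right : (CyclotomicZp.zpExtension 2).layer 2 ≤ _) he⟩ : ↥(ℚ⟮θ⟯ ⊔ (CyclotomicZp.zpExtension 2).layer 2)) ^ (k : ℕ)) := by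
  haveI : FiniteDimensional ℚ ↥ℚ⟮θ⟯ :=
    IntermediateField.adjoin.finiteDimensional ⟨_, Cubic.monic_of_a_eq_one', by rwa [← aeval_def]⟩
  haveI : FiniteDimensional ℚ ↥((CyclotomicZp.zpExtension 2).layer 1) := (CyclotomicZp.zpExtension 2).finiteDimensional_layer_holds 1
  haveI : FiniteDimensional ℚ ↥((CyclotomicZp.zpExtension 2).layer 2) := (CyclotomicZp.zpExtension 2).finiteDimensional_layer_holds 2
  haveI : NumberField ↥ℚ⟮θ⟯ := NumberField.mk
  haveI : NumberField ↥(ℚ⟮θ⟯ ⊔ (CyclotomicZp.zpExtension 2).layer 1) := NumberField.mk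
  haveI : NumberField ↥(ℚ⟮θ⟯ ⊔ (CyclotomicZp.zpExtension 2).layer 2) := NumberField.mk
  obtain ⟨-, hfin1, h3⟩ := layer_basics hirr hθ hreal 1
  obtain ⟨-, hfin2, -⟩ := layer_basics hirr hθ hreal 2
  have hodd3 : Odd (Module.finrank ℚ ↥ℚ⟮θ⟯) := by rw [h3]; decide
  -- the tower
  have hK1 : ℚ⟮θ⟯ ≤ ℚ⟮θ⟯ ⊔ (CyclotomicZp.zpExtension 2).layer 1 := le_sup_left
  have h12 : ℚ⟮θ⟯ ⊔ (CyclotomicZp.zpExtension 2).layer 1 ≤ ℚ⟮θ⟯ ⊔ (CyclotomicZp.zpExtension 2).layer 2 :=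
    sup_le_sup_left ((CyclotomicZp.zpExtension 2).layer_mono (by norm_num : 1 ≤ 2)) _
  letI : Algebra ↥ℚ⟮θ⟯ ↥(ℚ⟮θ⟯ ⊔ (CyclotomicZp.zpExtension 2).layer 1) := (IntermediateField.inclusion hK1).toRingHom.toAlgebra
  letI : Algebra ↥(ℚ⟮θ⟯ ⊔ (CyclotomicZp.zpExtension 2).layer 1) ↥(ℚ⟮θ⟯ ⊔ (CyclotomicZp.zpExtension 2).layer 2) :=
    (IntermediateField.inclusion h12).toRingHom.toAlgebra
  have halgK1 : ∀ c, algebraMap ↥ℚ⟮θ⟯ ↥(ℚ⟮θ⟯ ⊔ (CyclotomicZp.zpExtension 2).layer 1) c = IntermediateField.inclusion hK1 c := fun _ => rfl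
  have halg12 : ∀ c, algebraMap ↥(ℚ⟮θ⟯ ⊔ (CyclotomicZp.zpExtension 2).layer 1) ↥(ℚ⟮θ⟯ ⊔ (CyclotomicZp.zpExtension 2).layer 2) c =
      IntermediateField.inclusion h12 c := fun _ => rfl
  haveI : IsScalarTower ℚ ↥ℚ⟮θ⟯ ↥(ℚ⟮θ⟯ ⊔ (CyclotomicZp.zpExtension 2).layer 1) :=
    IsScalarTower.of_algebraMap_eq fun x => ((IntermediateField.inclusion hK1).commutes x).symm
  haveI : IsScalarTower ℚ ↥(ℚ⟮θ⟯ ⊔ (CyclotomicZp.zpExtension 2).layer 1) ↥(ℚ⟮θ⟯ ⊔ (CyclotomicZp.zpExtension 2).layer 2) :=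
    IsScalarTower.of_algebraMap_eq fun x => ((IntermediateField.inclusion h12).commutes x).symm
  haveI : Module.Finite ↥ℚ⟮θ⟯ ↥(ℚ⟮θ⟯ ⊔ (CyclotomicZp.zpExtension 2).layer 1) := Module.Finite.of_restrictScalars_finite ℚ _ _
  haveI : Module.Finite ↥(ℚ⟮θ⟯ ⊔ (CyclotomicZp.zpExtension 2).layer 1) ↥(ℚ⟮θ⟯ ⊔ (CyclotomicZp.zpExtension 2).layer 2) :=
    Module.Finite.of_restrictScalars_finite ℚ _ _
  have hdeg1 : Module.finrank ↥ℚ⟮θ⟯ ↥(ℚ⟮θ⟯ ⊔ (CyclotomicZp.zpExtension 2).layer 1) = 2 := by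
    have htower := Module.finrank_mul_finrank ℚ ↥ℚ⟮θ⟯ ↥(ℚ⟮θ⟯ ⊔ (CyclotomicZp.zpExtension 2).layer 1)
    rw [h3, hfin1] at htower
    omega
  have hdeg2 : Module.finrank ↥(ℚ⟮θ⟯ ⊔ (CyclotomicZp.zpExtension 2).layer 1) ↥(ℚ⟮θ⟯ ⊔ (CyclotomicZp.zpExtension 2).layer 2) = 2 := by
    have htower := Module.finrank_mul_finrank ℚ ↥(ℚ⟮θ⟯ ⊔ (CyclotomicZp.zpExtension 2).layer 1) ↥(ℚ⟮θ⟯ ⊔ (CyclotomicZp.zpExtension 2).layer 2)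
    rw [hfin1, hfin2] at htower
    omega
  have htow : ∀ x : ↥(ℚ⟮θ⟯ ⊔ (CyclotomicZp.zpExtension 2).layer 1),
      algebraMap ↥(ℚ⟮θ⟯ ⊔ (CyclotomicZp.zpExtension 2).layer 2) (AlgebraicClosure ℚ)
        (algebraMap ↥(ℚ⟮θ⟯ ⊔ (CyclotomicZp.zpExtension 2).layer 1) ↥(ℚ⟮θ⟯ ⊔ (CyclotomicZp.zpExtension 2).layer 2) x) =
      algebraMap ↥(ℚ⟮θ⟯ ⊔ (CyclotomicZp.zpExtension 2).layer 1) (AlgebraicClosure ℚ) x := by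
    intro x
    rw [halg12, IntermediateField.algebraMap_apply, IntermediateField.algebraMap_apply, IntermediateField.coe_inclusion]
  have htowK : ∀ x : ↥ℚ⟮θ⟯,
      algebraMap ↥(ℚ⟮θ⟯ ⊔ (CyclotomicZp.zpExtension 2).layer 1) (AlgebraicClosure ℚ)
        (algebraMap ↥ℚ⟮θ⟯ ↥(ℚ⟮θ⟯ ⊔ (CyclotomicZp.zpExtension 2).layer 1) x) =
      algebraMap ↥ℚ⟮θ⟯ (AlgebraicClosure ℚ) x := by
    intro x
    rw [halgK1, IntermediateField.algebraMap_apply, IntermediateField.algebraMap_apply, IntermediateField.coe_inclusion]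
  -- the elements `θ'' ∈ A₂`, `e'' ∈ A₂`, `s' = e² − 2 ∈ A₁`
  set θ'' : ↥(ℚ⟮θ⟯ ⊔ (CyclotomicZp.zpExtension 2).layer 2) :=
    inclusion (le_sup_left : ℚ⟮θ⟯ ≤ ℚ⟮θ⟯ ⊔ (CyclotomicZp.zpExtension 2).layer 2) (AdjoinSimple.gen ℚ θ) with hθ''def
  set e'' : ↥(ℚ⟮θ⟯ ⊔ (CyclotomicZp.zpExtension 2).layer 2) := ⟨e, (le_sup_right : (CyclotomicZp.zpExtension 2).layer 2 ≤ _) he⟩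
    with he''def
  have hs2 : (e ^ 2 - 2) ^ 2 = 2 := by
    have h := he0
    simp only [Function.iterate_succ, Function.iterate_zero, Function.comp_apply, id_eq] at h
    linear_combination h
  have hsmem : e ^ 2 - 2 ∈ (CyclotomicZp.zpExtension 2).layer 1 := by
    obtain ⟨t₀, ht₀, ht₀2⟩ := CyclotomicZp.exists_mem_layer_one_sq_eq_two_zpExtension
    rcases sq_eq_sq_iff_eq_or_eq_neg.mp (hs2.trans ht₀2.symm) with h | h
    · rw [h]; exact ht₀
    · rw [h]; exact neg_mem ht₀
  set s' : ↥(ℚ⟮θ⟯ ⊔ (CyclotomicZp.zpExtension 2).layer 1) :=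
    ⟨e ^ 2 - 2, (le_sup_right : (CyclotomicZp.zpExtension 2).layer 1 ≤ _) hsmem⟩ with hs'def
  have hs'val : algebraMap ↥(ℚ⟮θ⟯ ⊔ (CyclotomicZp.zpExtension 2).layer 1) (AlgebraicClosure ℚ) s' = e ^ 2 - 2 :=
    IntermediateField.algebraMap_apply _ _
  have he''val : algebraMap ↥(ℚ⟮θ⟯ ⊔ (CyclotomicZp.zpExtension 2).layer 2) (AlgebraicClosure ℚ) e'' = e :=
    IntermediateField.algebraMap_apply _ _
  have hs'2 : s' ^ 2 = 2 := by
    apply (algebraMap ↥(ℚ⟮θ⟯ ⊔ (CyclotomicZp.zpExtension 2).layer 1) (AlgebraicClosure ℚ)).injective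
    rw [map_pow, hs'val, map_ofNat]; exact hs2
  have hSE : algebraMap ↥(ℚ⟮θ⟯ ⊔ (CyclotomicZp.zpExtension 2).layer 1) ↥(ℚ⟮θ⟯ ⊔ (CyclotomicZp.zpExtension 2).layer 2) s' = e'' ^ 2 - 2 := by
    apply (algebraMap ↥(ℚ⟮θ⟯ ⊔ (CyclotomicZp.zpExtension 2).layer 2) (AlgebraicClosure ℚ)).injective
    rw [htow, hs'val, map_sub, map_pow, he''val, map_ofNat]
  have hθK : algebraMap ↥(ℚ⟮θ⟯ ⊔ (CyclotomicZp.zpExtension 2).layer 1) ↥(ℚ⟮θ⟯ ⊔ (CyclotomicZp.zpExtension 2).layer 2)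
      (algebraMap ↥ℚ⟮θ⟯ ↥(ℚ⟮θ⟯ ⊔ (CyclotomicZp.zpExtension 2).layer 1) (AdjoinSimple.gen ℚ θ)) = θ'' := by
    apply (algebraMap ↥(ℚ⟮θ⟯ ⊔ (CyclotomicZp.zpExtension 2).layer 2) (AlgebraicClosure ℚ)).injective
    rw [htow, htowK, hθ''def, IntermediateField.algebraMap_apply, IntermediateField.algebraMap_apply, IntermediateField.coe_inclusion]
  -- `e ∉ A₁` and `s ∉ ℚ(θ)` (degrees), so `A₂ = A₁ ⊕ A₁ e`, `A₁ = ℚ(θ) ⊕ ℚ(θ) s`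
  haveI : Module.Free ↥ℚ⟮θ⟯ ↥(ℚ⟮θ⟯ ⊔ (CyclotomicZp.zpExtension 2).layer 1) := Module.Free.of_divisionRing _ _
  have htFE : ∀ x : ↥(ℚ⟮θ⟯ ⊔ (CyclotomicZp.zpExtension 2).layer 1),
      algebraMap ↥(ℚ⟮θ⟯ ⊔ (CyclotomicZp.zpExtension 2).layer 1) ↥(ℚ⟮θ⟯ ⊔ (CyclotomicZp.zpExtension 2).layer 2) x ≠ e'' := by
    intro x hx
    have hx0 : (fun y : ↥(ℚ⟮θ⟯ ⊔ (CyclotomicZp.zpExtension 2).layer 1) => y ^ 2 - 2)^[2] x = 0 := by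
      apply (algebraMap ↥(ℚ⟮θ⟯ ⊔ (CyclotomicZp.zpExtension 2).layer 1) (AlgebraicClosure ℚ)).injective
      rw [NestedSqrtTwo.map_iterate, map_zero, ← htow, hx, he''val]; exact he0
    have hmin := NestedSqrtTwo.minpoly_eq_of_odd_finrank hodd3 (L := ↥(ℚ⟮θ⟯ ⊔ (CyclotomicZp.zpExtension 2).layer 1)) x hx0
    have hle := minpoly.natDegree_le (A := ↥ℚ⟮θ⟯) x
    rw [hmin, NestedSqrtTwo.natDegree_eq, hdeg1] at hle
    norm_num at hle
  have htFA : ∀ y : ↥ℚ⟮θ⟯, algebraMap ↥ℚ⟮θ⟯ ↥(ℚ⟮θ⟯ ⊔ (CyclotomicZp.zpExtension 2).layer 1) y ≠ s' := by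
    intro y hy
    have h1 : (fun x : ↥ℚ⟮θ⟯ => x ^ 2 - 2)^[1] y = 0 := by
      simp only [Function.iterate_one]
      apply (algebraMap ↥ℚ⟮θ⟯ ↥(ℚ⟮θ⟯ ⊔ (CyclotomicZp.zpExtension 2).layer 1)).injective
      rw [map_sub, map_pow, hy, hs'2, map_ofNat, map_zero, sub_self]
    exact NestedSqrtTwo.iterate_ne_zero_of_odd_finrank hodd3 (n := 1) le_rfl y h1
  have hspanE := exists_eq_add_mul_of_finrank_eq_two hdeg2 e'' htFE
  have hspanA := exists_eq_add_mul_of_finrank_eq_two hdeg1 s' htFA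
  -- integral versions of `s'`, `2 + s'`
  have hs'int : IsIntegral ℤ s' := ⟨X ^ 2 - C 2, monic_X_pow_sub_C _ two_ne_zero, by simp [hs'2]⟩
  set δ₂ : 𝓞 ↥(ℚ⟮θ⟯ ⊔ (CyclotomicZp.zpExtension 2).layer 1) := 2 + ⟨s', hs'int⟩ with hδ₂def
  have hδ₂val : ((δ₂ : 𝓞 ↥(ℚ⟮θ⟯ ⊔ (CyclotomicZp.zpExtension 2).layer 1)) : ↥(ℚ⟮θ⟯ ⊔ (CyclotomicZp.zpExtension 2).layer 1)) = 2 + s' := by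
    rw [hδ₂def]; push_cast; rfl
  have ht2 : e'' ^ 2 = algebraMap ↥(ℚ⟮θ⟯ ⊔ (CyclotomicZp.zpExtension 2).layer 1) ↥(ℚ⟮θ⟯ ⊔ (CyclotomicZp.zpExtension 2).layer 2)
      ((δ₂ : 𝓞 ↥(ℚ⟮θ⟯ ⊔ (CyclotomicZp.zpExtension 2).layer 1)) : ↥(ℚ⟮θ⟯ ⊔ (CyclotomicZp.zpExtension 2).layer 1)) := by
    rw [hδ₂val, map_add, map_ofNat, hSE]; ring
  -- layer `A₂ / A₁`
  obtain ⟨a, b, hab⟩ := exists_two_mul_mul_eq_add_mul_of_isIntegral e'' δ₂ ht2 hspanE htFE (z := (z : ↥(ℚ⟮θ⟯ ⊔ (CyclotomicZp.zpExtension 2).layer 2)))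
    (NumberField.RingOfIntegers.isIntegral_coe z)
  -- layer `A₁ / ℚ(θ)` for `a` and `b`
  have h22 : (((2 : 𝓞 ↥ℚ⟮θ⟯) : 𝓞 ↥ℚ⟮θ⟯) : ↥ℚ⟮θ⟯) = 2 := by
    rw [NumberField.RingOfIntegers.coe_eq_algebraMap, map_ofNat]
  have ht1 : s' ^ 2 = algebraMap ↥ℚ⟮θ⟯ ↥(ℚ⟮θ⟯ ⊔ (CyclotomicZp.zpExtension 2).layer 1) (((2 : 𝓞 ↥ℚ⟮θ⟯) : 𝓞 ↥ℚ⟮θ⟯) : ↥ℚ⟮θ⟯) := by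
    rw [hs'2, h22, map_ofNat]
  obtain ⟨a₁, a₂, ha⟩ := exists_two_mul_mul_eq_add_mul_of_isIntegral s' (2 : 𝓞 ↥ℚ⟮θ⟯) ht1 hspanA htFA
    (z := (a : ↥(ℚ⟮θ⟯ ⊔ (CyclotomicZp.zpExtension 2).layer 1))) (NumberField.RingOfIntegers.isIntegral_coe a)
  obtain ⟨b₁, b₂, hb⟩ := exists_two_mul_mul_eq_add_mul_of_isIntegral s' (2 : 𝓞 ↥ℚ⟮θ⟯) ht1 hspanA htFA
    (z := (b : ↥(ℚ⟮θ⟯ ⊔ (CyclotomicZp.zpExtension 2).layer 1))) (NumberField.RingOfIntegers.isIntegral_coe b)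
  -- `disc · 𝓞_{ℚ(θ)} ⊆ ℤ ⊕ ℤθ ⊕ ℤθ²`
  obtain ⟨n₀, n₁, n₂, hn⟩ := exists_discr_mul_eq_of_isIntegral_adjoin hirr hθ (NumberField.RingOfIntegers.isIntegral_coe a₁)
  obtain ⟨n₀', n₁', n₂', hn'⟩ := exists_discr_mul_eq_of_isIntegral_adjoin hirr hθ (NumberField.RingOfIntegers.isIntegral_coe a₂)
  obtain ⟨m₀, m₁, m₂, hm⟩ := exists_discr_mul_eq_of_isIntegral_adjoin hirr hθ (NumberField.RingOfIntegers.isIntegral_coe b₁)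
  obtain ⟨m₀', m₁', m₂', hm'⟩ := exists_discr_mul_eq_of_isIntegral_adjoin hirr hθ (NumberField.RingOfIntegers.isIntegral_coe b₂)
  -- push everything into `A₂`
  set ι₁ := algebraMap ↥(ℚ⟮θ⟯ ⊔ (CyclotomicZp.zpExtension 2).layer 1) ↥(ℚ⟮θ⟯ ⊔ (CyclotomicZp.zpExtension 2).layer 2) with hι₁
  set ι₀ := algebraMap ↥ℚ⟮θ⟯ ↥(ℚ⟮θ⟯ ⊔ (CyclotomicZp.zpExtension 2).layer 1) with hι₀
  set D : ℤ := Cubic.discr ⟨1, p, q, r⟩ with hD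
  have hab' : ι₁ (2 * (2 + s')) * (z : ↥(ℚ⟮θ⟯ ⊔ (CyclotomicZp.zpExtension 2).layer 2)) =
      ι₁ (a : ↥(ℚ⟮θ⟯ ⊔ (CyclotomicZp.zpExtension 2).layer 1)) + ι₁ (b : ↥(ℚ⟮θ⟯ ⊔ (CyclotomicZp.zpExtension 2).layer 1)) * e'' := by
    rw [← hδ₂val]; exact hab
  have ha' : ι₁ (ι₀ (2 * 2)) * ι₁ (a : ↥(ℚ⟮θ⟯ ⊔ (CyclotomicZp.zpExtension 2).layer 1)) =
      ι₁ (ι₀ (a₁ : ↥ℚ⟮θ⟯)) + ι₁ (ι₀ (a₂ : ↥ℚ⟮θ⟯)) * ι₁ s' := by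
    have h := congrArg ι₁ ha
    rw [map_mul, map_add, map_mul, h22] at h
    exact h
  have hb' : ι₁ (ι₀ (2 * 2)) * ι₁ (b : ↥(ℚ⟮θ⟯ ⊔ (CyclotomicZp.zpExtension 2).layer 1)) =
      ι₁ (ι₀ (b₁ : ↥ℚ⟮θ⟯)) + ι₁ (ι₀ (b₂ : ↥ℚ⟮θ⟯)) * ι₁ s' := by
    have h := congrArg ι₁ hb
    rw [map_mul, map_add, map_mul, h22] at h
    exact h
  have hgE : ι₁ (ι₀ (AdjoinSimple.gen ℚ θ)) = θ'' := hθK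
  have hcast : ∀ n : ℤ, ι₁ (ι₀ (n : ↥ℚ⟮θ⟯)) = (n : ↥(ℚ⟮θ⟯ ⊔ (CyclotomicZp.zpExtension 2).layer 2)) := by
    intro n; rw [map_intCast, map_intCast]
  have hn1 : (D : ↥(ℚ⟮θ⟯ ⊔ (CyclotomicZp.zpExtension 2).layer 2)) * ι₁ (ι₀ (a₁ : ↥ℚ⟮θ⟯)) = (n₀ : ↥(ℚ⟮θ⟯ ⊔ (CyclotomicZp.zpExtension 2).layer 2)) + (n₁ : ↥(ℚ⟮θ⟯ ⊔ (CyclotomicZp.zpExtension 2).layer 2)) * θ'' + (n₂ : ↥(ℚ⟮θ⟯ ⊔ (CyclotomicZp.zpExtension 2).layer 2)) * θ'' ^ 2 := by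
    have h := congrArg (fun w => ι₁ (ι₀ w)) hn
    simp only [map_mul, map_add, map_pow, hcast, hgE] at h; exact h
  have hn2 : (D : ↥(ℚ⟮θ⟯ ⊔ (CyclotomicZp.zpExtension 2).layer 2)) * ι₁ (ι₀ (a₂ : ↥ℚ⟮θ⟯)) = (n₀' : ↥(ℚ⟮θ⟯ ⊔ (CyclotomicZp.zpExtension 2).layer 2)) + (n₁' : ↥(ℚ⟮θ⟯ ⊔ (CyclotomicZp.zpExtension 2).layer 2)) * θ'' + (n₂' : ↥(ℚ⟮θ⟯ ⊔ (CyclotomicZp.zpExtension 2).layer 2)) * θ'' ^ 2 := by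
    have h := congrArg (fun w => ι₁ (ι₀ w)) hn'
    simp only [map_mul, map_add, map_pow, hcast, hgE] at h; exact h
  have hm1 : (D : ↥(ℚ⟮θ⟯ ⊔ (CyclotomicZp.zpExtension 2).layer 2)) * ι₁ (ι₀ (b₁ : ↥ℚ⟮θ⟯)) = (m₀ : ↥(ℚ⟮θ⟯ ⊔ (CyclotomicZp.zpExtension 2).layer 2)) + (m₁ : ↥(ℚ⟮θ⟯ ⊔ (CyclotomicZp.zpExtension 2).layer 2)) * θ'' + (m₂ : ↥(ℚ⟮θ⟯ ⊔ (CyclotomicZp.zpExtension 2).layer 2)) * θ'' ^ 2 := by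
    have h := congrArg (fun w => ι₁ (ι₀ w)) hm
    simp only [map_mul, map_add, map_pow, hcast, hgE] at h; exact h
  have hm2 : (D : ↥(ℚ⟮θ⟯ ⊔ (CyclotomicZp.zpExtension 2).layer 2)) * ι₁ (ι₀ (b₂ : ↥ℚ⟮θ⟯)) = (m₀' : ↥(ℚ⟮θ⟯ ⊔ (CyclotomicZp.zpExtension 2).layer 2)) + (m₁' : ↥(ℚ⟮θ⟯ ⊔ (CyclotomicZp.zpExtension 2).layer 2)) * θ'' + (m₂' : ↥(ℚ⟮θ⟯ ⊔ (CyclotomicZp.zpExtension 2).layer 2)) * θ'' ^ 2 := by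
    have h := congrArg (fun w => ι₁ (ι₀ w)) hm'
    simp only [map_mul, map_add, map_pow, hcast, hgE] at h; exact h
  have hS2 : (ι₁ s') ^ 2 = 2 := by rw [← map_pow, hs'2, map_ofNat]
  simp only [map_mul, map_add, map_ofNat] at hab' ha' hb'
  -- the coefficients
  refine ⟨![![4 * n₀ - 6 * n₀', 4 * m₀ - 6 * m₀', 2 * n₀' - n₀, 2 * m₀' - m₀],
           ![4 * n₁ - 6 * n₁', 4 * m₁ - 6 * m₁', 2 * n₁' - n₁, 2 * m₁' - m₁],
           ![4 * n₂ - 6 * n₂', 4 * m₂ - 6 * m₂', 2 * n₂' - n₂, 2 * m₂' - m₂]], ?_⟩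
  simp only [Fin.sum_univ_three, Fin.sum_univ_four, Matrix.cons_val_zero, Matrix.cons_val_one, Matrix.cons_val_two,
    Matrix.cons_val_three, Matrix.cons_val', Matrix.head_cons, Matrix.tail_cons, Fin.val_zero, Fin.val_one, Fin.val_two,
    pow_zero, pow_one, mul_one]
  have h3 : ((3 : Fin 4) : ℕ) = 3 := rfl
  rw [h3]
  push_cast
  linear_combination (4 * (D : ↥(ℚ⟮θ⟯ ⊔ (CyclotomicZp.zpExtension 2).layer 2)) * (2 - ι₁ s')) * hab' + ((D : ↥(ℚ⟮θ⟯ ⊔ (CyclotomicZp.zpExtension 2).layer 2)) * (2 - ι₁ s')) * ha' +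
    ((D : ↥(ℚ⟮θ⟯ ⊔ (CyclotomicZp.zpExtension 2).layer 2)) * (2 - ι₁ s') * e'') * hb' + (2 - ι₁ s') * hn1 + ((2 - ι₁ s') * ι₁ s') * hn2 +
    ((2 - ι₁ s') * e'') * hm1 + ((2 - ι₁ s') * ι₁ s' * e'') * hm2 +
    (8 * (D : ↥(ℚ⟮θ⟯ ⊔ (CyclotomicZp.zpExtension 2).layer 2)) * (z : ↥(ℚ⟮θ⟯ ⊔ (CyclotomicZp.zpExtension 2).layer 2)) - ((n₀' : ↥(ℚ⟮θ⟯ ⊔ (CyclotomicZp.zpExtension 2).layer 2)) + (n₁' : ↥(ℚ⟮θ⟯ ⊔ (CyclotomicZp.zpExtension 2).layer 2)) * θ'' + (n₂' : ↥(ℚ⟮θ⟯ ⊔ (CyclotomicZp.zpExtension 2).layer 2)) * θ'' ^ 2) -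
      ((m₀' : ↥(ℚ⟮θ⟯ ⊔ (CyclotomicZp.zpExtension 2).layer 2)) + (m₁' : ↥(ℚ⟮θ⟯ ⊔ (CyclotomicZp.zpExtension 2).layer 2)) * θ'' + (m₂' : ↥(ℚ⟮θ⟯ ⊔ (CyclotomicZp.zpExtension 2).layer 2)) * θ'' ^ 2) * e'') * hS2 +
    ((2 * ((n₀' : ↥(ℚ⟮θ⟯ ⊔ (CyclotomicZp.zpExtension 2).layer 2)) + (n₁' : ↥(ℚ⟮θ⟯ ⊔ (CyclotomicZp.zpExtension 2).layer 2)) * θ'' + (n₂' : ↥(ℚ⟮θ⟯ ⊔ (CyclotomicZp.zpExtension 2).layer 2)) * θ'' ^ 2) - ((n₀ : ↥(ℚ⟮θ⟯ ⊔ (CyclotomicZp.zpExtension 2).layer 2)) + (n₁ : ↥(ℚ⟮θ⟯ ⊔ (CyclotomicZp.zpExtension 2).layer 2)) * θ'' + (n₂ : ↥(ℚ⟮θ⟯ ⊔ (CyclotomicZp.zpExtension 2).layer 2)) * θ'' ^ 2)) +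
      (2 * ((m₀' : ↥(ℚ⟮θ⟯ ⊔ (CyclotomicZp.zpExtension 2).layer 2)) + (m₁' : ↥(ℚ⟮θ⟯ ⊔ (CyclotomicZp.zpExtension 2).layer 2)) * θ'' + (m₂' : ↥(ℚ⟮θ⟯ ⊔ (CyclotomicZp.zpExtension 2).layer 2)) * θ'' ^ 2) - ((m₀ : ↥(ℚ⟮θ⟯ ⊔ (CyclotomicZp.zpExtension 2).layer 2)) + (m₁ : ↥(ℚ⟮θ⟯ ⊔ (CyclotomicZp.zpExtension 2).layer 2)) * θ'' + (m₂ : ↥(ℚ⟮θ⟯ ⊔ (CyclotomicZp.zpExtension 2).layer 2)) * θ'' ^ 2)) * e'') * hSE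


end LayerTwo


end Summit.BirchSwinnertonDyer.BirchSwinnertonDyer.Theorems.AddKatoTwo

end
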